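import Mathlib
import HarnessLib
import Summits.NavierStokesRegularity.NavierStokesRegularity.Theorems.LocalSineTubeDoorSequentialZoom
import Summits.NavierStokesRegularity.NavierStokesRegularity.Theorems.LocalSineTubeDoorProfileAlignedWindowRigidity
import Summits.NavierStokesRegularity.NavierStokesRegularity.Theorems.PoloidalWindowDoorPoloidalWindowRigidityFlat

/-!
# The SEQUENTIAL two-point door template and the direction-free SEQUENTIAL CROSS DOOR (unconditional)

Cell ns-regularity-ideate, seat p6 (`--supports stmt-NavierStokesRegularity-20017`; rung N0-LocalTubeDoorSine neighbourhood).
Two-point window scalars `F(u(y), ∇u(y), u(y'), ∇u(y'))` integrated over `U × U` (the shape of the cell's LOCAL CROSS TUBE DOOR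
`…LocalSineTubeDoorCrossDoor.localTubeDoorCross`, nsreg-p1's aside, direction-free) with a ONE-SLICE pair crux admit the same
weakening of the time hypothesis as single-point scalars (`…SequentialDoor`): fading along ONE bounded-gap sequence of times.

* `sequentialPairDoor_of_oneSlicePairWindowRigidity` — template: any continuous `F(x, A, x', A')` with zero set invariant under
  `(x, A, x', A') ↦ (a x, b A, a x', b A')` (`a, b > 0`) and a one-slice PAIR crux («some `s < 0` and nonempty open `U'` with
  `F(v(s,z), Dv(s)(z), v(s,z'), Dv(s)(z')) = 0` for all `z, z' ∈ U'` ⇒ not backward-singular») ⇒ door along bounded-gap times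
  (via `…SequentialZoom.sequentialWindowZoom` + Fatou on `U × U`);
* `sequentialCrossDoor` — **UNCONDITIONAL, direction-free:** classical Leray–Hopf from rapidly decaying data, LOCAL Type I at
  `(x₀,T)`, `U` nonempty open, `tₖ → T` in `[0,T)` with `T − tₖ₊₁ ≥ c (T − tₖ)`, `c > 0`, and
  `∫_{U×U} ‖((T−tₖ) curl u(tₖ, x₀+√(T−tₖ)y)) × ((T−tₖ) curl u(tₖ, x₀+√(T−tₖ)y'))‖ d(y,y') → 0` ⇒ `u` stays bounded near `x₀` up to
  `T` (pair crux: pairwise-parallel vorticity on a window of ONE slice is parallel to one fixed `e ≠ 0` there, hence `v ≡ 0` by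
  `eq_zero_of_aligned_window`, item stmt-…-20018).  This is the LOCAL CROSS TUBE DOOR with its all-times hypothesis replaced by
  ONE bounded-gap sequence of times.

WHAT THIS IS NOT: not a claim about Navier–Stokes regularity (Clay A) — local, conditional-on-Type-I regularity CRITERIA;
establishment in the cell's sense needs the cross-family referee PASS + independent reproduction (bears_on LADDER-NS N0).
-/

noncomputable section

-- the summit and its single sub-problem share the name (CONVENTIONS §1), as in every Theorems file
set_option linter.dupNamespace false

namespace Summit.NavierStokesRegularity.NavierStokesRegularity.Theorems.LocalSineTubeDoorSequentialCrossDoor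

open MeasureTheory Set Function Filter Topology TopologicalSpace Metric
open scoped RealInnerProductSpace InnerProductSpace NNReal ENNReal
open Literature.Analysis Literature.Analysis.FluidPDE
open Summit.NavierStokesRegularity.NavierStokesRegularity.Theorems.LocalSineTubeDoorProfileAlignedWindowRigidityAncient
open Summit.NavierStokesRegularity.NavierStokesRegularity.Theorems.LocalSineTubeDoorProfileAlignedWindowRigidity
open Summit.NavierStokesRegularity.NavierStokesRegularity.Theorems.PoloidalWindowDoorPoloidalWindowRigidityFlat
open Summit.NavierStokesRegularity.NavierStokesRegularity.Theorems.LocalSineTubeDoorSequentialZoom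

/-- **SEQUENTIAL TWO-POINT DOOR TEMPLATE (one-slice pair cruxes).**  See the module docstring. -/
theorem sequentialPairDoor_of_oneSlicePairWindowRigidity
    (F : (EuclideanSpace ℝ (Fin 3)) → ((EuclideanSpace ℝ (Fin 3)) →L[ℝ] (EuclideanSpace ℝ (Fin 3))) → (EuclideanSpace ℝ (Fin 3)) → ((EuclideanSpace ℝ (Fin 3)) →L[ℝ] (EuclideanSpace ℝ (Fin 3))) → ℝ)
    (hF : Continuous fun q : ((EuclideanSpace ℝ (Fin 3)) × ((EuclideanSpace ℝ (Fin 3)) →L[ℝ] (EuclideanSpace ℝ (Fin 3)))) × ((EuclideanSpace ℝ (Fin 3)) × ((EuclideanSpace ℝ (Fin 3)) →L[ℝ] (EuclideanSpace ℝ (Fin 3)))) => F q.1.1 q.1.2 q.2.1 q.2.2)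
    (hzero : ∀ (a b : ℝ), 0 < a → 0 < b → ∀ (x : (EuclideanSpace ℝ (Fin 3))) (A : (EuclideanSpace ℝ (Fin 3)) →L[ℝ] (EuclideanSpace ℝ (Fin 3))) (x' : (EuclideanSpace ℝ (Fin 3))) (A' : (EuclideanSpace ℝ (Fin 3)) →L[ℝ] (EuclideanSpace ℝ (Fin 3))),
      F (a • x) (b • A) (a • x') (b • A') = 0 ↔ F x A x' A' = 0)
    (hcrux : ∀ (C : ℝ) (v : ℝ → (EuclideanSpace ℝ (Fin 3)) → (EuclideanSpace ℝ (Fin 3))),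
      Literature.Analysis.FluidPDE.HasTypeITimeDecay C v →
      ContinuousOn (Function.uncurry v) (Set.Iio (0 : ℝ) ×ˢ Set.univ) →
      (∀ s t : ℝ, s < t → t < 0 → ∀ x, v t x =
        Literature.Analysis.UnboundedOperators.heatExtension (v s) (t - s) x -
          Literature.Analysis.FluidPDE.oseenDuhamel 1 s v v t x) →
      (∀ t < 0, Literature.Analysis.FluidPDE.VectorCalculus.IsDivFree (v t)) →
      (∃ s < 0, ∃ U : Set (EuclideanSpace ℝ (Fin 3)), IsOpen U ∧ U.Nonempty ∧
        ∀ z ∈ U, ∀ z' ∈ U, F (v s z) (fderiv ℝ (v s) z) (v s z') (fderiv ℝ (v s) z') = 0) →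
      ¬ Literature.Analysis.FluidPDE.IsBackwardSingularPoint v 0) :
    ∀ (ν T : ℝ), 0 < ν → 0 < T → ∀ (u : ℝ → (EuclideanSpace ℝ (Fin 3)) → (EuclideanSpace ℝ (Fin 3))) (p : ℝ → (EuclideanSpace ℝ (Fin 3)) → ℝ),
    Literature.Analysis.FluidPDE.IsClassicalNSSolutionOn (Set.Ico 0 T) ν 0 u p →
    Literature.Analysis.FluidPDE.IsLerayHopfOn T ν 0 (u 0) u →
    Literature.Analysis.FluidPDE.HasRapidSpatialDecay (u 0) →
    ∀ (x₀ : (EuclideanSpace ℝ (Fin 3))) (ρ M : ℝ), 0 < ρ →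
    (∀ t ∈ Set.Ico 0 T, T - ρ ^ 2 < t → ∀ x ∈ Metric.ball x₀ ρ, ‖u t x‖ * Real.sqrt (ν * (T - t)) ≤ M) →
    ∀ (U : Set (EuclideanSpace ℝ (Fin 3))), IsOpen U → U.Nonempty →
    ∀ (t : ℕ → ℝ) (c : ℝ), 0 < c → (∀ k, t k ∈ Set.Ico 0 T) → Filter.Tendsto t Filter.atTop (nhds T) →
    (∀ k, c * (T - t k) ≤ T - t (k + 1)) →
    Filter.Tendsto (fun k => ∫⁻ q in U ×ˢ U, ENNReal.ofReal
      |F (Real.sqrt (T - t k) • u (t k) (x₀ + Real.sqrt (T - t k) • q.1))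
        (Real.sqrt (T - t k) ^ 2 • fderiv ℝ (u (t k)) (x₀ + Real.sqrt (T - t k) • q.1))
        (Real.sqrt (T - t k) • u (t k) (x₀ + Real.sqrt (T - t k) • q.2))
        (Real.sqrt (T - t k) ^ 2 • fderiv ℝ (u (t k)) (x₀ + Real.sqrt (T - t k) • q.2))|)
      Filter.atTop (nhds 0) →
    Literature.Analysis.FluidPDE.IsBackwardBoundedAt u T x₀ := by
  intro ν T hν hT u p hsol hLH _ x₀ ρ M hρ hM U hU hUne t c hc htk htT hgap hfade
  by_contra hnotbd
  obtain ⟨C, v, sstar, σinf, ksel, hP, hsing, hsstar, hσinf, hksel, hconv⟩ :=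
    sequentialWindowZoom hν hT hsol hLH hρ hM hnotbd hc htk htT hgap
  refine hcrux C v hP.1 hP.2.1 hP.2.2.1 hP.2.2.2 ?_ hsing
  -- window quantities along the selected times
  set W : ℕ → (EuclideanSpace ℝ (Fin 3)) → (EuclideanSpace ℝ (Fin 3)) := fun j y =>
    Real.sqrt (T - t (ksel j)) • u (t (ksel j)) (x₀ + Real.sqrt (T - t (ksel j)) • y) with hWdef
  set G : ℕ → (EuclideanSpace ℝ (Fin 3)) → ((EuclideanSpace ℝ (Fin 3)) →L[ℝ] (EuclideanSpace ℝ (Fin 3))) := fun j y =>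
    Real.sqrt (T - t (ksel j)) ^ 2 • fderiv ℝ (u (t (ksel j))) (x₀ + Real.sqrt (T - t (ksel j)) • y) with hGdef
  -- the limit pair scalar and its continuity
  set Lv : (EuclideanSpace ℝ (Fin 3)) → (EuclideanSpace ℝ (Fin 3)) := fun y => (σinf * ν) • v sstar (σinf • y) with hLvdef
  set LG : (EuclideanSpace ℝ (Fin 3)) → ((EuclideanSpace ℝ (Fin 3)) →L[ℝ] (EuclideanSpace ℝ (Fin 3))) := fun y => (σinf ^ 2 * ν) • fderiv ℝ (v sstar) (σinf • y) with hLGdef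
  set Hs : (EuclideanSpace ℝ (Fin 3)) × (EuclideanSpace ℝ (Fin 3)) → ℝ := fun q => F (Lv q.1) (LG q.1) (Lv q.2) (LG q.2) with hHsdef
  have han : AnalyticOnNhd ℝ (v sstar) univ :=
    analyticOnNhd_slice hP.2.1 (bdd_of_hasTypeITimeDecay hP.1) hP.2.2.1 hsstar
  have hvs : Continuous (v sstar) := by
    rw [← continuousOn_univ]; exact han.continuousOn
  have hDvs : Continuous (fderiv ℝ (v sstar)) := (han.contDiff (n := 1)).continuous_fderiv one_ne_zero
  have hLv : Continuous Lv := (hvs.comp (continuous_const_smul σinf)).const_smul (σinf * ν)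
  have hLG : Continuous LG := (hDvs.comp (continuous_const_smul σinf)).const_smul (σinf ^ 2 * ν)
  have hHscont : Continuous Hs := by
    show Continuous fun q : (EuclideanSpace ℝ (Fin 3)) × (EuclideanSpace ℝ (Fin 3)) => F (Lv q.1) (LG q.1) (Lv q.2) (LG q.2)
    exact hF.comp (((hLv.comp continuous_fst).prodMk (hLG.comp continuous_fst)).prodMk
      ((hLv.comp continuous_snd).prodMk (hLG.comp continuous_snd)))
  have hconvH : ∀ q : (EuclideanSpace ℝ (Fin 3)) × (EuclideanSpace ℝ (Fin 3)), Tendsto (fun j => F (W j q.1) (G j q.1) (W j q.2) (G j q.2)) atTop (𝓝 (Hs q)) := by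
    intro q
    exact (hF.tendsto _).comp (((hconv q.1).1.prodMk_nhds (hconv q.1).2).prodMk_nhds
      ((hconv q.2).1.prodMk_nhds (hconv q.2).2))
  -- measurability of the pair scalars (the selected times lie in `[0,T)`)
  have hφc : ∀ j, Continuous fun y : (EuclideanSpace ℝ (Fin 3)) => x₀ + Real.sqrt (T - t (ksel j)) • y :=
    fun j => continuous_const.add (continuous_const_smul _)
  have hWc : ∀ j, Continuous (W j) := fun j => by
    show Continuous fun y => Real.sqrt (T - t (ksel j)) • u (t (ksel j)) (x₀ + Real.sqrt (T - t (ksel j)) • y)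
    exact ((hsol.contDiff_velocity (htk _)).continuous.comp (hφc j)).const_smul (Real.sqrt (T - t (ksel j)))
  have hGc : ∀ j, Continuous (G j) := fun j => by
    show Continuous fun y =>
      Real.sqrt (T - t (ksel j)) ^ 2 • fderiv ℝ (u (t (ksel j))) (x₀ + Real.sqrt (T - t (ksel j)) • y)
    exact (((hsol.contDiff_velocity (htk _)).continuous_fderiv (by norm_cast)).comp (hφc j)).const_smul
      (Real.sqrt (T - t (ksel j)) ^ 2)
  have hFjc : ∀ j, Continuous fun q : (EuclideanSpace ℝ (Fin 3)) × (EuclideanSpace ℝ (Fin 3)) => F (W j q.1) (G j q.1) (W j q.2) (G j q.2) := fun j =>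
    hF.comp ((((hWc j).comp continuous_fst).prodMk ((hGc j).comp continuous_fst)).prodMk
      (((hWc j).comp continuous_snd).prodMk ((hGc j).comp continuous_snd)))
  have hfadej : Tendsto (fun j => ∫⁻ q in U ×ˢ U, ENNReal.ofReal |F (W j q.1) (G j q.1) (W j q.2) (G j q.2)|)
      atTop (𝓝 0) := hfade.comp hksel
  -- ## FATOU on `U × U`
  set g : (EuclideanSpace ℝ (Fin 3)) × (EuclideanSpace ℝ (Fin 3)) → ℝ≥0∞ := fun q => ENNReal.ofReal |Hs q| with hg
  have hgc : Continuous g := ENNReal.continuous_ofReal.comp (continuous_abs.comp hHscont)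
  have hgjm : ∀ j, Measurable fun q : (EuclideanSpace ℝ (Fin 3)) × (EuclideanSpace ℝ (Fin 3)) => ENNReal.ofReal |F (W j q.1) (G j q.1) (W j q.2) (G j q.2)| :=
    fun j => (ENNReal.continuous_ofReal.comp (continuous_abs.comp (hFjc j))).measurable
  have hptw : ∀ q, Tendsto (fun j => ENNReal.ofReal |F (W j q.1) (G j q.1) (W j q.2) (G j q.2)|) atTop (𝓝 (g q)) :=
    fun q => ENNReal.tendsto_ofReal ((continuous_abs.tendsto (Hs q)).comp (hconvH q))
  have hFatou : ∫⁻ q in U ×ˢ U, liminf (fun j => ENNReal.ofReal |F (W j q.1) (G j q.1) (W j q.2) (G j q.2)|) atTop ≤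
      liminf (fun j => ∫⁻ q in U ×ˢ U, ENNReal.ofReal |F (W j q.1) (G j q.1) (W j q.2) (G j q.2)|) atTop :=
    lintegral_liminf_le' (fun j => (hgjm j).aemeasurable)
  have hlim : (fun q => liminf (fun j => ENNReal.ofReal |F (W j q.1) (G j q.1) (W j q.2) (G j q.2)|) atTop) = g :=
    funext fun q => (hptw q).liminf_eq
  rw [hlim, hfadej.liminf_eq] at hFatou
  have hint : ∫⁻ q in U ×ˢ U, g q = 0 := le_antisymm hFatou bot_le
  have hae0 : ∀ᵐ q ∂(volume.restrict (U ×ˢ U)), g q = 0 := (lintegral_eq_zero_iff hgc.measurable).1 hint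
  have hmeasU : MeasurableSet (U ×ˢ U) := hU.measurableSet.prod hU.measurableSet
  rw [ae_restrict_iff' hmeasU] at hae0
  haveI : (volume : Measure ((EuclideanSpace ℝ (Fin 3)) × (EuclideanSpace ℝ (Fin 3)))).IsOpenPosMeasure := by
    rw [Measure.volume_eq_prod]; exact Measure.prod.instIsOpenPosMeasure
  have hzeroU : ∀ q ∈ U ×ˢ U, g q = 0 := by
    intro q hq
    by_contra hne
    set O : Set ((EuclideanSpace ℝ (Fin 3)) × (EuclideanSpace ℝ (Fin 3))) := (U ×ˢ U) ∩ g ⁻¹' (Ioi 0) with hO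
    have hOo : IsOpen O := (hU.prod hU).inter (isOpen_Ioi.preimage hgc)
    have hO0 : volume O = 0 := by
      rw [measure_eq_zero_iff_ae_notMem]
      filter_upwards [hae0] with q' hq'
      rintro ⟨h1, h2⟩
      have := hq' h1
      simp only [mem_preimage, mem_Ioi, this, lt_self_iff_false] at h2
    have hOe : O = ∅ := (hOo.measure_eq_zero_iff volume).1 hO0
    have hqO : q ∈ O := ⟨hq, by simpa [mem_preimage, mem_Ioi, pos_iff_ne_zero] using hne⟩
    rw [hOe] at hqO
    exact hqO
  -- ## the one-slice pair window in profile coordinates: `σ∞ • U` at the slice `s⋆`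
  refine ⟨sstar, hsstar, (fun z => σinf⁻¹ • z) ⁻¹' U, hU.preimage (continuous_const_smul σinf⁻¹), ?_,
    fun z hz z' hz' => ?_⟩
  · obtain ⟨u₀, hu₀⟩ := hUne
    refine ⟨σinf • u₀, ?_⟩
    show σinf⁻¹ • (σinf • u₀) ∈ U
    rwa [smul_smul, inv_mul_cancel₀ hσinf.ne', one_smul]
  · have h := hzeroU (σinf⁻¹ • z, σinf⁻¹ • z') ⟨hz, hz'⟩
    simp only [hg, ENNReal.ofReal_eq_zero] at h
    have h0 : Hs (σinf⁻¹ • z, σinf⁻¹ • z') = 0 := abs_eq_zero.1 (le_antisymm h (abs_nonneg _))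
    simp only [hHsdef, hLvdef, hLGdef, smul_smul, mul_inv_cancel₀ hσinf.ne', one_smul] at h0
    exact (hzero _ _ (mul_pos hσinf hν) (mul_pos (pow_pos hσinf 2) hν) _ _ _ _).1 h0

/-- **THE SEQUENTIAL CROSS DOOR (direction-free, unconditional).**  See the module docstring. -/
theorem sequentialCrossDoor :
    ∀ (ν T : ℝ), 0 < ν → 0 < T → ∀ (u : ℝ → (EuclideanSpace ℝ (Fin 3)) → (EuclideanSpace ℝ (Fin 3))) (p : ℝ → (EuclideanSpace ℝ (Fin 3)) → ℝ),
    Literature.Analysis.FluidPDE.IsClassicalNSSolutionOn (Set.Ico 0 T) ν 0 u p →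
    Literature.Analysis.FluidPDE.IsLerayHopfOn T ν 0 (u 0) u →
    Literature.Analysis.FluidPDE.HasRapidSpatialDecay (u 0) →
    ∀ (x₀ : (EuclideanSpace ℝ (Fin 3))) (ρ M : ℝ), 0 < ρ →
    (∀ t ∈ Set.Ico 0 T, T - ρ ^ 2 < t → ∀ x ∈ Metric.ball x₀ ρ, ‖u t x‖ * Real.sqrt (ν * (T - t)) ≤ M) →
    ∀ (U : Set (EuclideanSpace ℝ (Fin 3))), IsOpen U → U.Nonempty →
    ∀ (t : ℕ → ℝ) (c : ℝ), 0 < c → (∀ k, t k ∈ Set.Ico 0 T) → Filter.Tendsto t Filter.atTop (nhds T) →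
    (∀ k, c * (T - t k) ≤ T - t (k + 1)) →
    Filter.Tendsto (fun k => ∫⁻ q in U ×ˢ U, ENNReal.ofReal
      ‖Literature.Analysis.FluidPDE.cross
        ((T - t k) • Literature.Analysis.FluidPDE.curl (u (t k)) (x₀ + Real.sqrt (T - t k) • q.1))
        ((T - t k) • Literature.Analysis.FluidPDE.curl (u (t k)) (x₀ + Real.sqrt (T - t k) • q.2))‖)
      Filter.atTop (nhds 0) →
    Literature.Analysis.FluidPDE.IsBackwardBoundedAt u T x₀ := by
  intro ν T hν hT u p hsol hLH hdec x₀ ρ M hρ hM U hU hUne t c hc htk htT hgap hfade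
  -- the pair scalar `F(x, A, x', A') = ‖(curlCLM A) × (curlCLM A')‖`
  have hF : Continuous fun q : ((EuclideanSpace ℝ (Fin 3)) × ((EuclideanSpace ℝ (Fin 3)) →L[ℝ] (EuclideanSpace ℝ (Fin 3)))) × ((EuclideanSpace ℝ (Fin 3)) × ((EuclideanSpace ℝ (Fin 3)) →L[ℝ] (EuclideanSpace ℝ (Fin 3)))) =>
      ‖cross (curlCLM q.1.2) (curlCLM q.2.2)‖ := by
    have h : Continuous fun q : ((EuclideanSpace ℝ (Fin 3)) × ((EuclideanSpace ℝ (Fin 3)) →L[ℝ] (EuclideanSpace ℝ (Fin 3)))) × ((EuclideanSpace ℝ (Fin 3)) × ((EuclideanSpace ℝ (Fin 3)) →L[ℝ] (EuclideanSpace ℝ (Fin 3)))) =>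
        crossCLM (curlCLM q.1.2) (curlCLM q.2.2) :=
      crossCLM.continuous₂.comp ((curlCLM.continuous.comp (continuous_snd.comp continuous_fst)).prodMk
        (curlCLM.continuous.comp (continuous_snd.comp continuous_snd)))
    refine (continuous_norm.comp h).congr fun q => ?_
    simp only [Function.comp_apply, crossCLM_apply]
  have hzero : ∀ (a b : ℝ), 0 < a → 0 < b → ∀ (x : (EuclideanSpace ℝ (Fin 3))) (A : (EuclideanSpace ℝ (Fin 3)) →L[ℝ] (EuclideanSpace ℝ (Fin 3))) (x' : (EuclideanSpace ℝ (Fin 3))) (A' : (EuclideanSpace ℝ (Fin 3)) →L[ℝ] (EuclideanSpace ℝ (Fin 3))),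
      ‖cross (curlCLM (b • A)) (curlCLM (b • A'))‖ = 0 ↔ ‖cross (curlCLM A) (curlCLM A')‖ = 0 := by
    intro a b _ hb x A x' A'
    have h : cross (curlCLM (b • A)) (curlCLM (b • A')) = (b * b) • cross (curlCLM A) (curlCLM A') := by
      rw [map_smul, map_smul, ← crossCLM_apply, ← crossCLM_apply, map_smul, map_smul, smul_apply, smul_smul]
    rw [h, norm_smul, mul_eq_zero, Real.norm_eq_abs, abs_eq_zero, or_iff_right (mul_ne_zero hb.ne' hb.ne')]
  -- the one-slice pair crux: pairwise-parallel vorticity on a window of one slice ⇒ `v ≡ 0`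
  have hcrux : ∀ (C : ℝ) (v : ℝ → (EuclideanSpace ℝ (Fin 3)) → (EuclideanSpace ℝ (Fin 3))),
      Literature.Analysis.FluidPDE.HasTypeITimeDecay C v →
      ContinuousOn (Function.uncurry v) (Set.Iio (0 : ℝ) ×ˢ Set.univ) →
      (∀ s t : ℝ, s < t → t < 0 → ∀ x, v t x =
        Literature.Analysis.UnboundedOperators.heatExtension (v s) (t - s) x -
          Literature.Analysis.FluidPDE.oseenDuhamel 1 s v v t x) →
      (∀ t < 0, Literature.Analysis.FluidPDE.VectorCalculus.IsDivFree (v t)) →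
      (∃ s < 0, ∃ U : Set (EuclideanSpace ℝ (Fin 3)), IsOpen U ∧ U.Nonempty ∧
        ∀ z ∈ U, ∀ z' ∈ U, (fun (x : (EuclideanSpace ℝ (Fin 3))) (A : (EuclideanSpace ℝ (Fin 3)) →L[ℝ] (EuclideanSpace ℝ (Fin 3))) (x' : (EuclideanSpace ℝ (Fin 3))) (A' : (EuclideanSpace ℝ (Fin 3)) →L[ℝ] (EuclideanSpace ℝ (Fin 3))) =>
          ‖cross (curlCLM A) (curlCLM A')‖) (v s z) (fderiv ℝ (v s) z) (v s z') (fderiv ℝ (v s) z') = 0) →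
      ¬ Literature.Analysis.FluidPDE.IsBackwardSingularPoint v 0 := by
    intro C v hrate hcont hmild hdiv hwin
    obtain ⟨s, hs, U', hU', hne', hpair⟩ := hwin
    have hpair' : ∀ z ∈ U', ∀ z' ∈ U', cross (curl (v s) z) (curl (v s) z') = 0 := by
      intro z hz z' hz'
      have h := hpair z hz z' hz'
      simp only [norm_eq_zero] at h
      rwa [← curl_eq_curlCLM, ← curl_eq_curlCLM] at h
    have cross_zero_left : ∀ e : (EuclideanSpace ℝ (Fin 3)), cross 0 e = 0 := by
      intro e
      rw [← crossCLM_apply, map_zero, zero_apply]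
    -- the vorticity of the slice is parallel to ONE fixed non-zero vector on `U'`
    have hal : ∃ e : (EuclideanSpace ℝ (Fin 3)), e ≠ 0 ∧ ∀ z ∈ U', cross (curl (v s) z) e = 0 := by
      by_cases hex : ∃ z₀ ∈ U', curl (v s) z₀ ≠ 0
      · obtain ⟨z₀, hz₀, hne⟩ := hex
        exact ⟨curl (v s) z₀, hne, fun z hz => hpair' z hz z₀ hz₀⟩
      · push Not at hex
        refine ⟨EuclideanSpace.single 0 1, ?_, fun z hz => ?_⟩
        · intro h0
          have := congrArg (fun w : (EuclideanSpace ℝ (Fin 3)) => w 0) h0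
          simp at this
        · rw [hex z hz, cross_zero_left]
    obtain ⟨e, he, hale⟩ := hal
    exact not_backwardSingular_of_zero (eq_zero_of_aligned_window hrate hcont hmild hdiv hs he hU' hne' hale)
  refine sequentialPairDoor_of_oneSlicePairWindowRigidity (fun x A x' A' => ‖cross (curlCLM A) (curlCLM A')‖) hF hzero hcrux
    ν T hν hT u p hsol hLH hdec x₀ ρ M hρ hM U hU hUne t c hc htk htT hgap ?_
  -- the two window integrands agree on `[0,T)`
  refine hfade.congr fun k => ?_
  refine lintegral_congr fun q => ?_
  have ht : 0 ≤ T - t k := (sub_pos.2 (htk k).2).le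
  rw [map_smul, map_smul, ← curl_eq_curlCLM, ← curl_eq_curlCLM, Real.sq_sqrt ht, abs_norm]

end Summit.NavierStokesRegularity.NavierStokesRegularity.Theorems.LocalSineTubeDoorSequentialCrossDoor

end
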